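import Summits.QuantumFields.YangMills.Theorems.BalabanUVNodesN16KingModelBlockMeanShift
import Literature.MathematicalPhysics.QuantumFieldTheory.King1986.MinimizerTwoSpacingHolder

/-!
# Route «BalabanUVNodes» (K3⁵ `SpineGivenEndpointR13SepCoP`), DAG node N16 = NE3 — THE KING-MODEL RUNG OF NE3, HÖLDER LINE,
# PART 1 (pure lattice bookkeeping): TRANSLATING A FIBRE BY A COARSE VECTOR — the fibre of `x + v` is the fibre of `x` translated
# by the fine lift `Lⁿ·v`, and the translated fine pair `(x′, x′ + Lⁿ·v)` has the SAME unit-coordinate torus distance as the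
# coarse pair `(x, x + v)`

Cell `pub-ymgap`, seat `pub-ymgap-dag-n16-c` (R134 acceleration seat, strategy s1; HUMAN RULING D-0062; chair R424 venue), generation 8.
`--kind proof --supports stmt-QuantumFields-20296 --as helper` (K3⁵, plan g68 KEY-20 ∕ dag-lead WORDS-141).  `bears_on: R4∕N16 · row «R2^ϱ,
the unprinted core»`.

WHY THIS FILE.  The King-model rung of NE3 has its VALUE line (generation 7, `BalabanUVNodesN16KingModelTwoRun`) and its DERIVATIVE
line (generation 8, `…N16KingModelTwoRunDeriv(Sup)`, the template of (Lip₁ᶜ)).  Generations 2–4 of this seat re-typed N16's root at a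
HÖLDER exponent (`N16HolderDefs.CovRootHolder β`, `N16HolderMSDefs.CovRootHolderMS β`: the (1.36)₃-type Hölder member of the two-run
discrepancy direction, the currency the N05 leaf actually supplies and NE7 consumes).  Its scalar template is King's Prop. 3.8 (3.71)
LINE 3 — the Hölder quotient `|x − y|^{−α}` of the two-spacing discrepancy (`MinimizerTwoSpacingHolder.king_prop38_holder_torus`,
`MinimizerHolderDecay.king_prop38_holder_torus_blocks`, seat n18-b) — READ FOR THE BLOCK-AVERAGED DISCREPANCY `D = φ_k^ψ − Q_nφ_{k+n}^ψ`
at a pair of coarse points `(x, y = x + v)`.  King compares a fine pair `(x′, y′)` over `(x, y)` with its own distance `|x′ − y′|`; the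
block mean pairs each `x′` over `x` with its translate `y′ = x′ + Lⁿ·v` over `y` — and for THAT pairing the two distances coincide, so
line 3 applies term by term with ONE Hölder weight and NO dichotomy (contrast the derivative line).  This file is the lattice bookkeeping:
the translation of fibres by an arbitrary coarse vector (generalising PART 1 of the derivative line, `N16KingModelBlockShift`, from `e_μ`
to `v`) and the distance identity.

WHAT THIS FILE PROVES (kernel; theorems only — 0 `def`, 0 sorry; the fine lift of a coarse vector `v ∈ T_η = Tor (fine Lᵏ M)` is spelled
INLINE `(ν ↦ ((v_ν.val·Lⁿ : ℕ) : ℤ∕(LⁿLᵏM_ν)))`):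
* §1 `over_add_translate` (x′ over x ⇒ `x′ + Lⁿ·v` over `x + v`), `lift_neg` (the lift of `−v` is minus the lift of `v`), `over_sub_translate`,
  ★ `overFib_translate_eq_map` (fibre of `x + v` = fibre of `x` translated by `Lⁿ·v`), `blockMean_translate`, `blockMean_mul_sub`.
* §2 `circAbs_coord_add` ∕ `circAbs_coord_add_lift` (the coordinate distances of `(x, x + v)` and of `(x′, x′ + Lⁿ·v)`; the scaling
  `dist(Rz, RPℤ) = R·dist(z, Pℤ)` is lit-balaban's `B5Ineq137Torus.circAbs_mul_mul`), ★ `tdistT_translate` (`|x′ − (x′ + Lⁿ·v)|_{T_{η′}} = Lⁿ·|x − (x + v)|_{T_η}` in lattice units) and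
  ★ `holdist_translate` (EQUAL distances in unit coordinates: `holdist (LⁿLᵏ) M x′ (x′ + Lⁿ·v) = holdist Lᵏ M x (x + v)`).

HONEST FRAMING.  Lattice bookkeeping for a MODEL LAYER (King's `A = 0` scalar minimisers — template literature, printed AND proved);
nothing of [Balaban1985RegularSpaces] ∕ [Balaban1985Variational] is proved; N16 ∕ NE3 is NOT discharged (in-edges N05, N07 remain
hypotheses of the chain of record); count-neutral; finite tori — NOT ℝ⁴, NOT infinite volume, NOT OS, NOT a mass gap, NOT Clay.

Sources: C. King, *The U(1) Higgs model. I. The continuum limit*, Commun. Math. Phys. **102** (1986) 649–677 [King1986], (2.4) p. 652,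
Prop. 3.8 (3.71) p. 664 (line 3, «x′ ∈ Bⁿ(x)»), (3.62) p. 663 (the Hölder quotient `∂_α(x, y)`), (4.1) p. 670.
-/

set_option autoImplicit false

noncomputable section

open Finset
open scoped BigOperators

namespace Summit.QuantumFields.YangMills.BalabanUVNodes.N16KingModelTranslate

open Literature.MathematicalPhysics.QuantumFieldTheory.Balaban1983to89.B5Prop11Plancherel (Tor fine)
open Literature.MathematicalPhysics.QuantumFieldTheory.Balaban1983to89.B4TorusKernel.MultiPeriod (circAbs circAbs_add_mul)
open Literature.MathematicalPhysics.QuantumFieldTheory.Balaban1983to89.B4Sect5Torus (circAbs_neg)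
open Literature.MathematicalPhysics.QuantumFieldTheory.Balaban1983to89.B5Ineq137Torus (circAbs_mul_mul)
open Literature.MathematicalPhysics.QuantumFieldTheory.King1986.Torus
  (tdistT tdistT_nonneg tdistT_eq_zero_of_d circAbs_le_tdistT exists_coord_eq_tdistT holdist)

variable {d : ℕ}

/-! ## §1 Translating «x′ over x» and the fibre by a coarse vector `v` (fine lift `Lⁿ·v`) -/

section Translate

variable {L : ℕ} [NeZero L] {M : Fin d → ℕ} [∀ μ, NeZero (M μ)] {k n : ℕ}

/-- **Translating both points**: if `x′ ∈ T_{η′}` lies over `x ∈ T_η` then `x′ + Lⁿ·v` lies over `x + v` for every coarse vector `v`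
(coordinatewise: `⌊(x′_ν + Lⁿv_ν)∕Lⁿ⌋ = ⌊x′_ν∕Lⁿ⌋ + v_ν` and both tori wrap consistently). [cite: King1986, Prop. 3.8 p.664, (4.1) p.670] -/
theorem over_add_translate (x : Tor (fine (L ^ k) M)) (x' : Tor (fine (L ^ n * L ^ k) M))
    (hx : ∀ ν, (x ν).val = (x' ν).val / L ^ n) (v : Tor (fine (L ^ k) M)) :
    ∀ ν, ((x + v) ν).val
      = ((x' + fun ν => (((v ν).val * L ^ n : ℕ) : ZMod (fine (L ^ n * L ^ k) M ν))) ν).val / L ^ n := by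
  have hL : 0 < L := Nat.pos_of_ne_zero (NeZero.ne L)
  have hLn : 0 < L ^ n := pow_pos hL n
  intro ν
  rw [Pi.add_apply, Pi.add_apply, ZMod.val_add, ZMod.val_add, ZMod.val_natCast, Nat.add_mod_mod, hx ν]
  show ((x' ν).val / L ^ n + (v ν).val) % (L ^ k * M ν) = ((x' ν).val + (v ν).val * L ^ n) % (L ^ n * L ^ k * M ν) / L ^ n
  rw [mul_assoc, Nat.mod_mul_right_div_self, Nat.add_mul_div_right _ _ hLn]

/-- **The lift of `−v` is minus the lift of `v`** (in `ℤ∕(LⁿLᵏM_ν)`: `(LᵏM_ν − v_ν)·Lⁿ ≡ −v_ν·Lⁿ`). [folklore] -/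
theorem lift_neg (v : Tor (fine (L ^ k) M)) (ν : Fin d) :
    ((((-v) ν).val * L ^ n : ℕ) : ZMod (fine (L ^ n * L ^ k) M ν))
      = -((((v ν).val * L ^ n : ℕ)) : ZMod (fine (L ^ n * L ^ k) M ν)) := by
  rw [Pi.neg_apply, ZMod.neg_val]
  split_ifs with h
  · simp [h]
  · have ha : (v ν).val * L ^ n ≤ fine (L ^ k) M ν * L ^ n := Nat.mul_le_mul_right _ (ZMod.val_lt _).le
    have hP : ((fine (L ^ k) M ν * L ^ n : ℕ) : ZMod (fine (L ^ n * L ^ k) M ν)) = 0 := by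
      rw [show fine (L ^ k) M ν * L ^ n = fine (L ^ n * L ^ k) M ν from by
        show L ^ k * M ν * L ^ n = L ^ n * L ^ k * M ν; ring]
      exact ZMod.natCast_self _
    rw [Nat.sub_mul, Nat.cast_sub ha, hP, zero_sub]

/-- **Translating back**: if `y ∈ T_{η′}` lies over `x + v` then `y − Lⁿ·v` lies over `x`. [cite: King1986, Prop. 3.8 p.664] -/
theorem over_sub_translate (x v : Tor (fine (L ^ k) M)) (y : Tor (fine (L ^ n * L ^ k) M))
    (hy : ∀ ν, ((x + v) ν).val = (y ν).val / L ^ n) :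
    ∀ ν, (x ν).val
      = ((y - fun ν => (((v ν).val * L ^ n : ℕ) : ZMod (fine (L ^ n * L ^ k) M ν))) ν).val / L ^ n := by
  have h := over_add_translate (x + v) y hy (-v)
  have hfun : (fun ν => ((((-v) ν).val * L ^ n : ℕ) : ZMod (fine (L ^ n * L ^ k) M ν)))
      = -(fun ν => ((((v ν).val * L ^ n : ℕ)) : ZMod (fine (L ^ n * L ^ k) M ν))) := by
    funext ν
    exact lift_neg v ν
  rw [add_neg_cancel_right, hfun, ← sub_eq_add_neg] at h
  exact h

/-- ★ **THE FIBRE OF `x + v` IS THE FIBRE OF `x` TRANSLATED BY THE FINE LIFT `Lⁿ·v`** (`Bⁿ(x + v) = Bⁿ(x) + Lⁿv` as finite subsets of the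
fine torus). [cite: King1986, Prop. 3.8 p.664, (4.1) p.670] -/
theorem overFib_translate_eq_map (x v : Tor (fine (L ^ k) M)) :
    (Finset.univ.filter fun y : Tor (fine (L ^ n * L ^ k) M) => ∀ ν, ((x + v) ν).val = (y ν).val / L ^ n)
      = (Finset.univ.filter fun x' : Tor (fine (L ^ n * L ^ k) M) => ∀ ν, (x ν).val = (x' ν).val / L ^ n).map
          (addRightEmbedding (fun ν => (((v ν).val * L ^ n : ℕ) : ZMod (fine (L ^ n * L ^ k) M ν)))) := by
  ext y
  simp only [Finset.mem_map, Finset.mem_filter, Finset.mem_univ, true_and, addRightEmbedding_apply]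
  constructor
  · intro hy
    exact ⟨y - fun ν => (((v ν).val * L ^ n : ℕ) : ZMod (fine (L ^ n * L ^ k) M ν)),
      over_sub_translate x v y hy, sub_add_cancel _ _⟩
  · rintro ⟨x', hx', rfl⟩
    exact over_add_translate x x' hx' v

/-- **The block mean at `x + v` is the mean over the fibre of `x` of the `Lⁿ·v`-translate**:
`(Q_nf)(x + v) = |Bⁿ(x)|⁻¹ Σ_{x′ over x} f(x′ + Lⁿ·v)`. [cite: King1986, (2.4) p.652, (4.1) p.670] -/
theorem blockMean_translate (x v : Tor (fine (L ^ k) M)) (f : Tor (fine (L ^ n * L ^ k) M) → ℝ) :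
    (((Finset.univ.filter fun y : Tor (fine (L ^ n * L ^ k) M) =>
          ∀ ν, ((x + v) ν).val = (y ν).val / L ^ n).card : ℝ))⁻¹ *
        ∑ y ∈ (Finset.univ.filter fun y : Tor (fine (L ^ n * L ^ k) M) => ∀ ν, ((x + v) ν).val = (y ν).val / L ^ n), f y
      = (((Finset.univ.filter fun x' : Tor (fine (L ^ n * L ^ k) M) => ∀ ν, (x ν).val = (x' ν).val / L ^ n).card : ℝ))⁻¹ *
        ∑ x' ∈ (Finset.univ.filter fun x' : Tor (fine (L ^ n * L ^ k) M) => ∀ ν, (x ν).val = (x' ν).val / L ^ n),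
          f (x' + fun ν => (((v ν).val * L ^ n : ℕ) : ZMod (fine (L ^ n * L ^ k) M ν))) := by
  rw [overFib_translate_eq_map, Finset.card_map, Finset.sum_map]
  rfl

/-- A weight times a difference of means is the mean of the weighted differences. [folklore] -/
theorem blockMean_mul_sub {T : Type*} (F : Finset T) (f g : T → ℝ) (w : ℝ) :
    ((F.card : ℝ))⁻¹ * ∑ x ∈ F, w * (f x - g x) = w * (((F.card : ℝ))⁻¹ * ∑ x ∈ F, f x - ((F.card : ℝ))⁻¹ * ∑ x ∈ F, g x) := by
  rw [← Finset.mul_sum, Finset.sum_sub_distrib]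
  ring

end Translate

/-! ## §2 The translated fine pair and the coarse pair have the same unit-coordinate distance -/

section Dist

variable {K : Fin d → ℕ} [∀ μ, NeZero (K μ)]

/-- The `ν`-th circular coordinate distance of the pair `(x, x + v)` is `dist(v_ν, K_νℤ)`. [folklore] -/
theorem circAbs_coord_add (x v : Tor K) (ν : Fin d) :
    circAbs (K ν) ((((x ν).val : ℤ)) - (((x + v) ν).val : ℤ)) = circAbs (K ν) ((v ν).val : ℤ) := by
  rw [Pi.add_apply, ZMod.val_add]
  have hq := Nat.mod_add_div ((x ν).val + (v ν).val) (K ν)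
  have hz : (((x ν).val : ℤ)) - ((((x ν).val + (v ν).val) % K ν : ℕ) : ℤ)
      = -((v ν).val : ℤ) + (K ν : ℤ) * ((((x ν).val + (v ν).val) / K ν : ℕ) : ℤ) := by
    have hq' : (((((x ν).val + (v ν).val) % K ν : ℕ) : ℤ))
        + (K ν : ℤ) * ((((x ν).val + (v ν).val) / K ν : ℕ) : ℤ) = ((x ν).val : ℤ) + ((v ν).val : ℤ) := by
      exact_mod_cast hq
    linarith
  rw [hz, circAbs_add_mul, circAbs_neg (Nat.one_le_iff_ne_zero.mpr (NeZero.ne (K ν)))]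

end Dist

section DistTranslate

variable {L : ℕ} [NeZero L] {M : Fin d → ℕ} [∀ μ, NeZero (M μ)] {k n : ℕ}

/-- The `ν`-th circular coordinate distance of the translated fine pair `(x′, x′ + Lⁿ·v)` is `Lⁿ·dist(v_ν, LᵏM_νℤ)`. [folklore] -/
theorem circAbs_coord_add_lift (x' : Tor (fine (L ^ n * L ^ k) M)) (v : Tor (fine (L ^ k) M)) (ν : Fin d) :
    circAbs (fine (L ^ n * L ^ k) M ν) ((((x' ν).val : ℤ))
        - (((x' + fun ν => (((v ν).val * L ^ n : ℕ) : ZMod (fine (L ^ n * L ^ k) M ν))) ν).val : ℤ))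
      = ((L ^ n : ℕ) : ℤ) * circAbs (L ^ k * M ν) ((v ν).val : ℤ) := by
  have hL : 0 < L := Nat.pos_of_ne_zero (NeZero.ne L)
  have hLn : 0 < L ^ n := pow_pos hL n
  rw [Pi.add_apply, ZMod.val_add, ZMod.val_natCast, Nat.add_mod_mod]
  show circAbs (L ^ n * L ^ k * M ν) ((((x' ν).val : ℤ)) - ((((x' ν).val + (v ν).val * L ^ n) % (L ^ n * L ^ k * M ν) : ℕ) : ℤ))
      = ((L ^ n : ℕ) : ℤ) * circAbs (L ^ k * M ν) ((v ν).val : ℤ)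
  have hq := Nat.mod_add_div ((x' ν).val + (v ν).val * L ^ n) (L ^ n * L ^ k * M ν)
  have hz : (((x' ν).val : ℤ)) - ((((x' ν).val + (v ν).val * L ^ n) % (L ^ n * L ^ k * M ν) : ℕ) : ℤ)
      = -(((L ^ n : ℕ) : ℤ) * ((v ν).val : ℤ))
        + ((L ^ n * L ^ k * M ν : ℕ) : ℤ) * ((((x' ν).val + (v ν).val * L ^ n) / (L ^ n * L ^ k * M ν) : ℕ) : ℤ) := by
    have hq' : (((((x' ν).val + (v ν).val * L ^ n) % (L ^ n * L ^ k * M ν) : ℕ) : ℤ))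
        + ((L ^ n * L ^ k * M ν : ℕ) : ℤ) * ((((x' ν).val + (v ν).val * L ^ n) / (L ^ n * L ^ k * M ν) : ℕ) : ℤ)
          = ((x' ν).val : ℤ) + ((v ν).val : ℤ) * ((L ^ n : ℕ) : ℤ) := by
      exact_mod_cast hq
    linarith
  rw [hz, circAbs_add_mul, circAbs_neg (Nat.one_le_iff_ne_zero.mpr (NeZero.ne _)), mul_assoc,
    circAbs_mul_mul hLn]

/-- ★ **THE TRANSLATED FINE PAIR IS `Lⁿ` TIMES AS FAR APART IN LATTICE UNITS**: for every fine point `x′` (over `x` or not) and every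
coarse vector `v`, `tdistT (fine (LⁿLᵏ) M) x′ (x′ + Lⁿ·v) = Lⁿ·tdistT (fine Lᵏ M) x (x + v)` (both are the sup over `ν` of the coordinate
distances of §2, which scale by `Lⁿ`). [folklore] -/
theorem tdistT_translate (x v : Tor (fine (L ^ k) M)) (x' : Tor (fine (L ^ n * L ^ k) M)) :
    tdistT (fine (L ^ n * L ^ k) M) x' (x' + fun ν => (((v ν).val * L ^ n : ℕ) : ZMod (fine (L ^ n * L ^ k) M ν)))
      = ((L ^ n : ℕ) : ℝ) * tdistT (fine (L ^ k) M) x (x + v) := by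
  by_cases hd : d = 0
  · rw [tdistT_eq_zero_of_d _ hd, tdistT_eq_zero_of_d _ hd, mul_zero]
  refine le_antisymm ?_ ?_
  · obtain ⟨μ, hμ⟩ := exists_coord_eq_tdistT (fine (L ^ n * L ^ k) M) hd x'
      (x' + fun ν => (((v ν).val * L ^ n : ℕ) : ZMod (fine (L ^ n * L ^ k) M ν)))
    rw [hμ, circAbs_coord_add_lift]
    have h := circAbs_le_tdistT (fine (L ^ k) M) x (x + v) μ
    rw [circAbs_coord_add] at h
    push_cast
    exact mul_le_mul_of_nonneg_left h (by positivity)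
  · obtain ⟨μ, hμ⟩ := exists_coord_eq_tdistT (fine (L ^ k) M) hd x (x + v)
    rw [hμ, circAbs_coord_add]
    have h := circAbs_le_tdistT (fine (L ^ n * L ^ k) M) x'
      (x' + fun ν => (((v ν).val * L ^ n : ℕ) : ZMod (fine (L ^ n * L ^ k) M ν))) μ
    rw [circAbs_coord_add_lift] at h
    exact_mod_cast h

/-- ★ **EQUAL UNIT-COORDINATE DISTANCES**: `holdist (LⁿLᵏ) M x′ (x′ + Lⁿ·v) = holdist Lᵏ M x (x + v)` — King's Hölder weight `|x′ − y′|^{−α}`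
for the translated fine pair equals the weight `|x − y|^{−α}` of the coarse pair (`η′·Lⁿ = η`). [cite: King1986, (3.62) p.663, Prop. 3.8 (3.71) p.664] -/
theorem holdist_translate (x v : Tor (fine (L ^ k) M)) (x' : Tor (fine (L ^ n * L ^ k) M)) :
    holdist (L ^ n * L ^ k) M x' (x' + fun ν => (((v ν).val * L ^ n : ℕ) : ZMod (fine (L ^ n * L ^ k) M ν)))
      = holdist (L ^ k) M x (x + v) := by
  have hL : (L : ℝ) ≠ 0 := by exact_mod_cast NeZero.ne L
  unfold holdist
  rw [tdistT_translate]
  push_cast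
  field_simp

end DistTranslate

end Summit.QuantumFields.YangMills.BalabanUVNodes.N16KingModelTranslate

end
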